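import Summits.Ventures.Crystal3D.LocalLP.SaturationGap
import Summits.Ventures.Crystal3D.LocalLP.ClassicalInputsDischarged
import Summits.Ventures.Crystal3D.Bulk.HoleForm
import Summits.Ventures.Crystal3D.TopCut.CapD10u58Proof
import HarnessLib

/-!
# Kissing saturation `(K)` from the cell's OWN gap rungs (Flyspeck-free): `SaturationInput r` from `GapTuple δ` / `NoHole t`

HONEST FRAMING. Part of the venture `Summits/Ventures/Crystal3D` (cell `pub-crystal3d`; drafted by
seat theory-1 (g5), landed with the unconditional tail by seat typer-bulk-2 (g5)). `LocalLP/SaturationGap.lean` reduces H2's named input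
`(K)` = `SaturationInput r` (`2/2.52 < r ≤ 1`) to Flyspeck's `flyspeck_L12` through the `2.52`
twelve-neighbour gap. The argument uses NOTHING about `2.52` except that it is a twelve-neighbour
gap: this file repeats it VERBATIM with the gap constant a parameter `δ` (radius-`1` units), i.e.
from the cell's fourteen-ball statement `GapTuple δ` (`Bulk/GapReduction.lean`), and then feeds it
the cell's own rungs: `GapTupleDiam d₀` (diameter units, `gapTupleDiam_iff`), the angular form
`NoHole t` (`Bulk/HoleForm.lean`, `gapTupleDiam_of_noHole`), and the tree's unconditional kernel
rung `TopCut.CapD10u58.noHole_cert : NoHole 0.58`. Results: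

* `exposedCap_eq_empty_of_gapTuple`, `saturationInput_of_gapTuple : GapTuple δ → 0 < δ →
  2/δ < r → r ≤ 1 → SaturationInput r`;
* `saturationInput_of_gapTupleDiam : GapTupleDiam d₀ → 0 < d₀ → 1/d₀ < r → r ≤ 1 → SaturationInput r`;
* `saturationInput_of_noHole : NoHole t → 0 < t → 1/(2t) < r → r ≤ 1 → SaturationInput r`;
* at H2's radius `rH2 = 1783/2000`: `saturationInput_H2_of_noHole : NoHole t → 1000/1783 < t →
  SaturationInput rH2` — ANY rung `NoHole t` with `t > 1000/1783 = 0.56085…` discharges H2's `(K)`;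
* **unconditionally**: the tree's kernel rung `TopCut.CapD10u58.noHole_cert : NoHole 0.58` (seat p2,
  `TopCut/CapD10u58Proof.lean`, standard axioms, no hypothesis) covers it, whence
  `saturationInput_of_lt : 25/29 < r → r ≤ 1 → SaturationInput r`, **`saturationInput_H2 :
  SaturationInput rH2`**, `H2_surfaceBound_of_capInputs : LevyCapInput rH2 FH2 → IsoInput rH2 sH2 →
  ∀ N ≥ 2, ∀ packing, C < 6N - (79/25) N^{2/3}` and **`surfaceBound_H2_of_capTable_dod :
  LevyCapInput rH2 FH2 → HalesDSP_truncatedDodecahedral → SurfaceBound (79/25)`** — the H2 rung with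
  `flyspeck_L12` REMOVED from its trust base (it was used only for `(K)`).

No crystallization statement is claimed; `(L)` and `(I)` remain hypotheses exactly as in
`LocalLP/H2Instance.lean`.
-/

noncomputable section

open scoped BigOperators RealInnerProductSpace
open Finset

namespace Summit.Ventures.Crystal3D

variable {N : ℕ} {x : Fin N → EuclideanSpace ℝ (Fin 3)}

/-- **No exposed direction below a twelve-neighbour gap `δ`** (radius-`1` units): if `GapTuple δ`
holds with `δ > 0`, then in a packing of diameter-`1` balls a ball with twelve contacts has no
exposed direction at any probing radius `2/δ < r ≤ 1`. The proof is that of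
`exposedCap_eq_empty_of_L12` with `hales_twelveNeighbourGap_of_L12` replaced by the hypothesis. -/
theorem exposedCap_eq_empty_of_gapTuple {δ : ℝ} (hG : GapTuple δ) (hδ : 0 < δ) {r : ℝ}
    (hr : 2 / δ < r) (hr1 : r ≤ 1) (hx : IsUnitPacking x) (i : Fin N)
    (h12 : coordination x i = 12) : exposedCap x r i = ∅ := by
  classical
  have hr0 : 0 < r := lt_trans (div_pos (by norm_num) hδ) hr
  ext u
  simp only [exposedCap, Set.mem_setOf_eq, Set.mem_empty_iff_false, iff_false, not_and]
  intro hu hfar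
  have hcard : (contactNeighbors x i).card = 12 := h12
  set nbI : Fin 12 ↪o Fin N := (contactNeighbors x i).orderEmbOfFin hcard with hnbI
  have hmem : ∀ a, nbI a ∈ contactNeighbors x i := fun a =>
    (contactNeighbors x i).orderEmbOfFin_mem hcard a
  set q : EuclideanSpace ℝ (Fin 3) := x i + r⁻¹ • u with hq
  obtain ⟨c, hpack, htouch, hc0, hc13⟩ := fourteen_of_twelve
    (p₀ := (2 : ℝ) • x i) (q := (2 : ℝ) • q) (nb := fun a => (2 : ℝ) • x (nbI a))
    (fun a => by rw [dist_two_smul, dist_comm, ((mem_contactNeighbors x).1 (hmem a)).2]; norm_num)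
    (fun a b hab => by
      rw [dist_two_smul]
      have : nbI a ≠ nbI b := fun h => hab (nbI.injective h)
      linarith [hx this])
    (by
      rw [dist_two_smul, hq, dist_eq_norm, sub_add_cancel_left, norm_neg, norm_smul,
        Real.norm_eq_abs, abs_of_pos (inv_pos.2 hr0), hu, mul_one]
      have : 1 ≤ r⁻¹ := one_le_inv_iff₀.2 ⟨hr0, hr1⟩
      linarith)
    (fun a => by
      rw [dist_two_smul, dist_comm, hq, dist_eq_norm]
      have hji : nbI a ≠ i := ((mem_contactNeighbors x).1 (hmem a)).1
      have hcontact : dist (x i) (x (nbI a)) = 1 := ((mem_contactNeighbors x).1 (hmem a)).2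
      have he : ‖x (nbI a) - x i‖ = 1 := by rw [← dist_eq_norm, dist_comm]; exact hcontact
      have hfar' : r ≤ ‖r • u - (x (nbI a) - x i)‖ := by
        have h := hfar (nbI a) hji
        rw [dist_eq_norm] at h
        have : x i + r • u - x (nbI a) = r • u - (x (nbI a) - x i) := by abel
        rwa [this] at h
      have h1 := one_le_norm_inv_smul_sub hu he hr0 hfar'
      have : x i + r⁻¹ • u - x (nbI a) = r⁻¹ • u - (x (nbI a) - x i) := by abel
      rw [this]
      linarith)
  have hgap := hG c hpack htouch
  rw [hc0, hc13, dist_two_smul, hq, dist_eq_norm] at hgap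
  have hnorm : ‖x i - (x i + r⁻¹ • u)‖ = r⁻¹ := by
    rw [sub_add_cancel_left, norm_neg, norm_smul, Real.norm_eq_abs, abs_of_pos (inv_pos.2 hr0),
      hu, mul_one]
  rw [hnorm] at hgap
  -- `δ ≤ 2 / r` contradicts `2 / δ < r`
  have h1 : δ * r ≤ 2 := by
    have := mul_le_mul_of_nonneg_right hgap hr0.le
    rwa [mul_assoc, inv_mul_cancel₀ hr0.ne', mul_one] at this
  have h2 : (2 : ℝ) < δ * r := by
    have := mul_lt_mul_of_pos_left hr hδ
    rwa [mul_div_cancel₀ _ hδ.ne'] at this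
  linarith

/-- **`(K)` below a twelve-neighbour gap `δ`** (radius-`1` units). -/
theorem saturationInput_of_gapTuple {δ : ℝ} (hG : GapTuple δ) (hδ : 0 < δ) {r : ℝ}
    (hr : 2 / δ < r) (hr1 : r ≤ 1) : SaturationInput r := by
  intro N x hx i h12
  unfold exposedFraction
  rw [exposedCap_eq_empty_of_gapTuple hG hδ hr hr1 hx i h12]
  exact ballFraction_rayCone_empty

/-- **`(K)` from the diameter-unit gap** `GapTupleDiam d₀` at every radius `1/d₀ < r ≤ 1`. -/
theorem saturationInput_of_gapTupleDiam {d₀ : ℝ} (hG : GapTupleDiam d₀) (hd : 0 < d₀) {r : ℝ}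
    (hr : 1 / d₀ < r) (hr1 : r ≤ 1) : SaturationInput r :=
  saturationInput_of_gapTuple ((gapTupleDiam_iff d₀).1 hG) (by positivity)
    (by rwa [show (2 : ℝ) / (2 * d₀) = 1 / d₀ by field_simp]) hr1

/-- **`(K)` from the angular statement `NoHole t`** (the cell's certified object) at every radius
`1/(2t) < r ≤ 1`. -/
theorem saturationInput_of_noHole {t : ℝ} (h : NoHole t) (ht : 0 < t) {r : ℝ}
    (hr : 1 / (2 * t) < r) (hr1 : r ≤ 1) : SaturationInput r :=
  saturationInput_of_gapTupleDiam (d₀ := 2 * t)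
    (gapTupleDiam_of_noHole (by rwa [show (2 * t) / 2 = t by ring])) (by positivity) hr hr1

/-- **H2's `(K)` from any rung `NoHole t` with `t > 1000/1783 = 0.56085…`.** -/
theorem saturationInput_H2_of_noHole {t : ℝ} (h : NoHole t) (ht : 1000 / 1783 < t) :
    SaturationInput rH2 := by
  have ht0 : 0 < t := lt_trans (by norm_num) ht
  refine saturationInput_of_noHole h ht0 ?_ (by norm_num [rH2])
  rw [rH2, div_lt_div_iff₀ (by positivity) (by norm_num)]
  nlinarith

/-- **`(K)` UNCONDITIONALLY at every probing radius `25/29 < r ≤ 1`** (diameter-`1` units), from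
the tree's kernel rung `TopCut.CapD10u58.noHole_cert : NoHole 0.58` (seat p2; standard axioms, no
hypothesis): `1/(2 · 0.58) = 25/29 = 0.862…`. -/
theorem saturationInput_of_lt {r : ℝ} (hr : 25 / 29 < r) (hr1 : r ≤ 1) : SaturationInput r :=
  saturationInput_of_noHole TopCut.CapD10u58.noHole_cert (by norm_num)
    (by rw [show (1 : ℝ) / (2 * 0.58) = 25 / 29 by norm_num]; exact hr) hr1

/-- **H2's `(K)` is a THEOREM**: `SaturationInput rH2` (`rH2 = 1783/2000`), unconditionally, from the
kernel rung `NoHole 0.58` (`0.58 > 1000/1783`). This discharges the hypothesis `hK` of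
`H2_surfaceBound` (`LocalLP/H2Instance.lean`) with NO appeal to Flyspeck's `L12`. -/
theorem saturationInput_H2 : SaturationInput rH2 :=
  saturationInput_H2_of_noHole TopCut.CapD10u58.noHole_cert (by norm_num)

/-- **H2 with `(K)` discharged in the kernel**: the cap input `(L)` (engine-2's certified table at
`rH2`) and the isoperimetric input `(I)` at `rH2` give `C(x) < 6N - (79/25) N^{2/3}` for every
packing of `N ≥ 2` diameter-`1` balls. Trust base: {(L), (I)} — `flyspeck_L12` is GONE
(compare `H2_surfaceBound_of_L12`, `LocalLP/SaturationGap.lean`). -/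
theorem H2_surfaceBound_of_capInputs (hL : LevyCapInput rH2 FH2) (hI : IsoInput rH2 sH2) :
    ∀ N : ℕ, 2 ≤ N → ∀ x : Fin N → EuclideanSpace ℝ (Fin 3), IsUnitPacking x →
      (numContacts x : ℝ) < 6 * N - (79 / 25 : ℝ) * (N : ℝ) ^ ((2 : ℝ) / 3) :=
  H2_surfaceBound hL saturationInput_H2 hI

open Literature.Geometry.DiscreteGeometry (Federer1969_isoperimetricUnionBalls_holds
  HalesDSP_truncatedDodecahedral) in
/-- **The H2 rung `SurfaceBound (79/25)` WITHOUT `flyspeck_L12`**: from the cell's certified cap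
table `(L)` at `rH2` and the Hales–McLaughlin dodecahedral volume bound alone (Federer's
isoperimetric inequality and the Lévy–Schmidt inequality are tree theorems, `(K)` is
`saturationInput_H2`). Compare `surfaceBound_H2_of_capTable`
(`LocalLP/ClassicalInputsDischarged.lean`), whose extra hypothesis `flyspeck_L12` this removes.
Remaining trust base of the `3.16` rung: {`LevyCapInput rH2 FH2`, `HalesDSP_truncatedDodecahedral`}. -/
theorem surfaceBound_H2_of_capTable_dod (hL : LevyCapInput rH2 FH2)
    (hD : HalesDSP_truncatedDodecahedral) : SurfaceBound (79 / 25) :=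
  fun N hN x hx => H2_surfaceBound_of_capInputs hL
    (isoInput_H2_of_dod_federer hD Federer1969_isoperimetricUnionBalls_holds) N hN x hx

end Summit.Ventures.Crystal3D

end
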